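import Literature.IUT.HodgeTheaters.InitialThetaDataBadPlaceOrdProofs
import Literature.NumberTheory.EllipticCurves.MultiplicativeReductionJValuationProofs
import Summits.ABC.IUTFork.LanaQPilotTheta
import HarnessLib

/-!
# L-LANA objects VIII quater: the `q`-pilot input AT THE LEVEL OF `K` — `ord_{v̲}(q_{v̲}) = e(v̲|v)·ord_v(q_v)` (N7, last row)

Record-only, proof-mostly sequel (D-0012; seat abc-iut-c312-4 gen 6, L-LANA level, plan/LLANA-SPEC N7) of
`LanaQPilotTheta.lean` (gen 3: LANA §4.2 (c)'s `q`-pilot input `QPilotInput.ofInitialThetaData D S` at the level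
of the places of `F`, with the modelling note "(i) … The `K_{v̲}`-level order is `e(v̲|v)·ord_v(q_v)` (base change of
multiplicative reduction along `K/F`) — not here").  TAKES NO SIDE on [IUTchIII] Cor. 3.12.  LANA §4.2 (c) p. 26
indexes the local pilots by `V = V̲ ⊆ 𝕍(K)` (Def. 2.5.1 p. 13: a section of `𝕍(K) ↠ 𝕍_mod`) and [IUTchI]
Ex. 3.2 (iv) p. 71 reads the `q`-parameter "of the elliptic curve `E_v̲` over `K_v̲`".  Layer L5 has since landed
the plumbing (abc-iut-L5-t2 / w5-d158: `InitialThetaDataPlaces` — `D.Vbad ⊆ V̲` finite nonempty;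
`InitialThetaDataBadPlaceOrdProofs` — odd residue characteristic, `l ∉ 𝔭_{v̲}`, multiplicative reduction below
`v̲`, `Γ_K` fixes `E_K[l]`; `MultiplicativeReductionBaseChangeTorsionProofs`,
`MultiplicativeReductionJValuationProofs` — classical Silverman VII.5.1), so THIS file closes RESIDUAL-LANA row N7:

* `badPrimesK D` — `V̲^bad` as a finite NONEMPTY set of primes of `𝓞 K` (the members of the section `V̲` over
  `𝕍^bad_mod`; ONE prime of `K` over each bad prime of `F_mod`, as LANA's `V`);
* `hasMultiplicativeReductionAt_baseChange_of_over_VbadMod` — `E_K := E_F ⊗_F K` has MULTIPLICATIVE reduction at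
  every prime `v̲` of `K` over `𝕍^bad_mod` (Silverman VII.5.1/VII.6.1 via the tree, fed with Def. 3.1 (b)(c));
* **`qParamOrd_baseChange_eq_mul`**: `ord_{v̲}(q_{v̲}) = e(v̲|v) · ord_v(q_v)` (`v = v̲ ∩ 𝓞_F`; both sides are
  `-ord(j)` at a multiplicative place, and `|j|_{v̲} = |j|_v^{e}` — Mathlib `valuation_liesOver`);
* `qParamOrd_baseChange_pos`, `two_mul_l_dvd_qParamOrd_baseChange` — `ord_{v̲}(q_{v̲}) > 0` and `2l ∣ ord_{v̲}(q_{v̲})`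
  ([IUTchI] Ex. 3.2 (iv): "`q_v̲` admits a `2l`-th root", valuation half = L5's
  `two_mul_l_dvd_ordMinimalDiscriminant`), so LANA's `q̲_v̲` has INTEGRAL order `ord_{v̲}(q_{v̲})/2l`;
* **`QPilotInput.ofInitialThetaDataK D S`** — the `q`-pilot input over `K`: `V^bad := V̲^bad`,
  `ord_{v̲}(q_{v̲}) := qParamOrd (E ⊗ K) v̲` with positivity PROVED; whence (gen 0 `LanaDegreesBridge`) the skeleton-XIV
  `LocalDegrees` and LANA §10.5's non-commuting hexagon FOR `E_K` (`hexagon_not_commute_thetaDataK`).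

Honest scope: the `2l`-th ROOT itself (unit part of `q_{v̲}`, Tate uniformisation) is not claimed (as in L5);
`deg` is gen 0's `[K:ℚ]`-normalised `qPilotBad` over `K`.
[cite: LANA2026Report, §4.2 (c) p. 26, Def. 2.5.1 p. 13] [claim: Mochizuki2012, status: disputed] NOT here: any judgement.
-/

noncomputable section

namespace Summit.ABC
namespace IUTFork

open NumberField IsDedekindDomain WeierstrassCurve
open Literature.IUT.HodgeTheaters (InitialThetaData BadPlacePredicates qParamOrd fieldOfModuli toVMod Val)

universe v w

variable {F : Type} {K : Type} {Fbar : Type w} [Field F] [NumberField F] [Field K] [NumberField K]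
  [Algebra F K] [Field Fbar] [Algebra F Fbar] [Algebra K Fbar] {E : WeierstrassCurve F} [E.IsElliptic]
  {l : ℕ} {P : BadPlacePredicates K} (D : InitialThetaData F K Fbar E l P)

namespace InitialThetaData

/-! ## 1. `V̲^bad` as a finite nonempty set of primes of `K` -/

/-- **`V̲^bad`** (LANA's `V^bad ⊆ V`; [IUTchI] Def. 3.1 (e)/(f): the members of the section `V̲ ⊆ 𝕍(K)` over
`𝕍^bad_mod`; L5's `D.Vbad`, finite by `Vbad_finite`) as a finite set of primes of `𝓞 K`.
[cite: LANA2026Report, §4.2 (c) p. 26] [claim: Mochizuki2012, status: disputed] -/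
def badPrimesK : Finset (HeightOneSpectrum (𝓞 K)) :=
  ((D.Vbad_finite.preimage (Set.injOn_of_injective Sum.inr_injective)).image FinitePlace.maximalIdeal).toFinset

/-- Membership: `v̲ ∈ V̲^bad` iff `v̲` is the prime of a finite place `x` of `K` with `x ∈ D.Vbad`.
[claim: Mochizuki2012, status: disputed] -/
theorem mem_badPrimesK_iff (w : HeightOneSpectrum (𝓞 K)) :
    w ∈ badPrimesK D ↔ ∃ x : FinitePlace K, Val.non x ∈ D.Vbad ∧ FinitePlace.maximalIdeal x = w := by
  simp only [badPrimesK, Set.Finite.mem_toFinset, Set.mem_image, Set.mem_preimage]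
  rfl

/-- A member of `V̲^bad` lies over `𝕍^bad_mod` (the hypothesis shape of L5's `InitialThetaDataBadPlaceOrdProofs`).
[claim: Mochizuki2012, status: disputed] -/
theorem over_VbadMod_of_mem_badPrimesK {w : HeightOneSpectrum (𝓞 K)} (hw : w ∈ badPrimesK D) :
    toVMod F K E (Val.non (FinitePlace.mk w)) ∈ Val.non '' D.VbadMod := by
  obtain ⟨x, hx, rfl⟩ := (mem_badPrimesK_iff D w).mp hw
  rw [FinitePlace.mk_maximalIdeal]
  exact hx.2

/-- **`V̲^bad ≠ ∅`** (L5 `Vbad_nonempty`; `V̲^bad ⊆ V̲^non` consists of finite places).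
[claim: Mochizuki2012, status: disputed] -/
theorem badPrimesK_nonempty : (badPrimesK D).Nonempty := by
  obtain ⟨y, hy⟩ := D.Vbad_nonempty
  have hnon := D.Vbad_subset_Vnon hy
  rcases y with y | x
  · exact absurd hnon.2 (by simp [Literature.IUT.HodgeTheaters.Val.IsNon])
  · exact ⟨FinitePlace.maximalIdeal x, (mem_badPrimesK_iff D _).mpr ⟨x, hy, rfl⟩⟩

/-! ## 2. Multiplicative reduction of `E_K` over `V̲^bad`; `ord_{v̲}(q_{v̲}) = e(v̲|v)·ord_v(q_v)` -/

/-- **`E_K` has multiplicative reduction at every prime of `K` over `𝕍^bad_mod`** — `E_F` is multiplicative below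
(Def. 3.1 (b)), `l ≥ 5` is prime to the place (Def. 3.1 (c)) and `Γ_K` fixes `E_K[l]` (`K = F(E_F[l])`), so `E_K`
is semistable there (Raynaud / [IUTchIV] Prop. 1.8 (v), the tree's theorem) and `|j|_{v̲} > 1` excludes good
reduction (Silverman VII.5.1). [claim: Mochizuki2012, status: disputed] [cite: SilvermanAEC2009, VII.5 Prop. 5.1(b)] -/
theorem hasMultiplicativeReductionAt_baseChange_of_over_VbadMod (w : HeightOneSpectrum (𝓞 K))
    (hw : toVMod F K E (Val.non (FinitePlace.mk w)) ∈ Val.non '' D.VbadMod) :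
    (E.baseChange K).HasMultiplicativeReductionAt w := by
  haveI : w.asIdeal.LiesOver (w.under (𝓞 F)).asIdeal := ⟨rfl⟩
  exact E.hasMultiplicativeReductionAt_baseChange_of_forall_smul_geomTorsion_eq
    (D.hasMultiplicativeReductionAt_under_of_over_VbadMod w hw) D.l_prime (by have := D.five_le_l; omega)
    (D.l_notMem_of_over_VbadMod w hw) D.smul_geomTorsion_l_eq

/-- **`ord_{v̲}(q_{v̲}) = e(v̲|v) · ord_v(q_v)`** for a prime `v̲` of `K` over `𝕍^bad_mod` and `v := v̲ ∩ 𝓞_F`: at a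
multiplicative place `ord(q) = ord(Δ_min) = -ord(j)` on both levels (Silverman VII.5.1 (b), the tree's
`valuation_j_eq_exp_ordMinimalDiscriminant_of_hasMultiplicativeReductionAt`), `j(E_K) = j(E_F)`, and
`|x|_{v̲} = |x|_v^{e(v̲|v)}` (Mathlib `valuation_liesOver`) — the base change of multiplicative reduction along
`K/F` that RESIDUAL-LANA row N7 asked for. [cite: LANA2026Report, §4.2 (c) p. 26] [cite: SilvermanAEC2009, VII.5 Prop. 5.1(b)] -/
theorem qParamOrd_baseChange_eq_mul (w : HeightOneSpectrum (𝓞 K))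
    (hw : toVMod F K E (Val.non (FinitePlace.mk w)) ∈ Val.non '' D.VbadMod) :
    qParamOrd (E.baseChange K) w = (w.under (𝓞 F)).asIdeal.ramificationIdx' w.asIdeal * qParamOrd E (w.under (𝓞 F)) := by
  haveI : w.asIdeal.LiesOver (w.under (𝓞 F)).asIdeal := ⟨rfl⟩
  haveI : (E.baseChange K).IsElliptic := by unfold WeierstrassCurve.baseChange; infer_instance
  have hv := D.hasMultiplicativeReductionAt_under_of_over_VbadMod w hw
  have hwm := hasMultiplicativeReductionAt_baseChange_of_over_VbadMod D w hw
  have hj : (E.baseChange K).j = algebraMap F K E.j := by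
    unfold WeierstrassCurve.baseChange
    exact E.map_j _
  have h := IsDedekindDomain.HeightOneSpectrum.valuation_liesOver K (w.under (𝓞 F)) w E.j
  rw [E.valuation_j_eq_exp_ordMinimalDiscriminant_of_hasMultiplicativeReductionAt (w.under (𝓞 F)) hv, ← hj,
    (E.baseChange K).valuation_j_eq_exp_ordMinimalDiscriminant_of_hasMultiplicativeReductionAt w hwm,
    ← WithZero.exp_nsmul, Int.nsmul_eq_mul, WithZero.exp_inj] at h
  unfold qParamOrd
  exact_mod_cast h.symm

/-- **`ord_{v̲}(q_{v̲}) > 0`** over `𝕍^bad_mod` (multiplicative reduction of `E_K`, the tree's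
`ordMinimalDiscriminant_ne_zero_of_hasMultiplicativeReductionAt`). [claim: Mochizuki2012, status: disputed] -/
theorem qParamOrd_baseChange_pos (w : HeightOneSpectrum (𝓞 K))
    (hw : toVMod F K E (Val.non (FinitePlace.mk w)) ∈ Val.non '' D.VbadMod) : 0 < qParamOrd (E.baseChange K) w := by
  haveI : (E.baseChange K).IsElliptic := by unfold WeierstrassCurve.baseChange; infer_instance
  exact Nat.pos_of_ne_zero
    (WeierstrassCurve.ordMinimalDiscriminant_ne_zero_of_hasMultiplicativeReductionAt w (E.baseChange K)
      (hasMultiplicativeReductionAt_baseChange_of_over_VbadMod D w hw))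

/-- **`2l ∣ ord_{v̲}(q_{v̲})`** over `𝕍^bad_mod` ([IUTchI] Ex. 3.2 (iv), valuation half — L5's theorem
`two_mul_l_dvd_ordMinimalDiscriminant`, restated on `qParamOrd`). [claim: Mochizuki2012, status: disputed] -/
theorem two_mul_l_dvd_qParamOrd_baseChange (w : HeightOneSpectrum (𝓞 K))
    (hw : toVMod F K E (Val.non (FinitePlace.mk w)) ∈ Val.non '' D.VbadMod) : 2 * l ∣ qParamOrd (E.baseChange K) w :=
  D.two_mul_l_dvd_ordMinimalDiscriminant w hw

end InitialThetaData

/-! ## 3. The `q`-pilot input over `K` -/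

namespace QPilotInput

/-- **LANA §4.2 (c)'s `q`-pilot input AT THE LEVEL OF `K`** (the places `V = V̲ ⊆ 𝕍(K)` of the initial Θ-data):
`l`, `V^bad := V̲^bad`, `ord_{v̲}(q_{v̲}) := qParamOrd (E ⊗ K) v̲` (`> 0` PROVED), the good finite places truncated to
a finite `S` (gen 3's modelling note (ii)), `#V^arc :=` the number of infinite places of `K`.
[cite: LANA2026Report, §4.2 (c) p. 26] [claim: Mochizuki2012, status: disputed] -/
def ofInitialThetaDataK (S : Finset (HeightOneSpectrum (𝓞 K))) : QPilotInput K where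
  l := l
  five_le := D.five_le_l
  bad := InitialThetaData.badPrimesK D
  bad_nonempty := InitialThetaData.badPrimesK_nonempty D
  good := S
  nArc := Fintype.card (InfinitePlace K)
  ordq := qParamOrd (E.baseChange K)
  ordq_pos _ hw := InitialThetaData.qParamOrd_baseChange_pos D _ (InitialThetaData.over_VbadMod_of_mem_badPrimesK D hw)

variable (S : Finset (HeightOneSpectrum (𝓞 K)))

/-- The prime of the `K`-level input is `l`. [cite: LANA2026Report, §4.2 (c) p. 26] -/
@[simp] theorem ofInitialThetaDataK_l : (ofInitialThetaDataK D S).l = l := rfl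

/-- `V^bad` of the `K`-level input is `V̲^bad`. [cite: LANA2026Report, §4.2 (c) p. 26] -/
@[simp] theorem ofInitialThetaDataK_bad : (ofInitialThetaDataK D S).bad = InitialThetaData.badPrimesK D := rfl

/-- `ord_{v̲}(q_{v̲})` of the `K`-level input is `qParamOrd (E ⊗ K) v̲`. [cite: LANA2026Report, §4.2 (c) p. 26] -/
@[simp] theorem ofInitialThetaDataK_ordq (w : HeightOneSpectrum (𝓞 K)) :
    (ofInitialThetaDataK D S).ordq w = qParamOrd (E.baseChange K) w := rfl

/-- **`K`-level vs `F`-level inputs**: on `V̲^bad`, `ord_{v̲}(q_{v̲}) = e(v̲|v)·ord_v(q_v)` with `v := v̲ ∩ 𝓞_F` and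
`ord_v(q_v)` the `F`-level input's (gen 3 `ofInitialThetaData`). [cite: LANA2026Report, §4.2 (c) p. 26] -/
theorem ofInitialThetaDataK_ordq_eq_mul (S' : Finset (HeightOneSpectrum (𝓞 F))) {w : HeightOneSpectrum (𝓞 K)}
    (hw : w ∈ (ofInitialThetaDataK D S).bad) :
    (ofInitialThetaDataK D S).ordq w =
      (w.under (𝓞 F)).asIdeal.ramificationIdx' w.asIdeal * (ofInitialThetaData D S').ordq (w.under (𝓞 F)) :=
  InitialThetaData.qParamOrd_baseChange_eq_mul D w (InitialThetaData.over_VbadMod_of_mem_badPrimesK D hw)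

/-- **The bad local pilot over `K` is `deg(q̲_{v̲}) = ord(q̲_{v̲}) · deg(π_{v̲})` with `ord(q̲_{v̲}) = ord_{v̲}(q_{v̲})/2l`
INTEGRAL** (gen 0's `qPilotBad` = `ord_{v̲}(q_{v̲})/(2l) · deg(π_{v̲})`; the exactness of the division is [IUTchI]
Ex. 3.2 (iv)). [cite: LANA2026Report, §4.2 (c) p. 26] -/
theorem ofInitialThetaDataK_d_bad (v : ↥(InitialThetaData.badPrimesK D)) :
    (ofInitialThetaDataK D S).d (Sum.inl (Sum.inl v)) = qPilotBad v.1 l (qParamOrd (E.baseChange K) v.1) := rfl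

/-- `2l ∣ ord_{v̲}(q_{v̲})` for the `K`-level input's bad places. [claim: Mochizuki2012, status: disputed] -/
theorem ofInitialThetaDataK_two_mul_l_dvd_ordq {w : HeightOneSpectrum (𝓞 K)} (hw : w ∈ (ofInitialThetaDataK D S).bad) :
    2 * l ∣ (ofInitialThetaDataK D S).ordq w :=
  InitialThetaData.two_mul_l_dvd_qParamOrd_baseChange D w (InitialThetaData.over_VbadMod_of_mem_badPrimesK D hw)

/-- The pilot `φ_C = Σ_{v̲ ∈ V̲^bad} deg(q̲_{v̲})` of the `K`-level input is positive (gen 0 `pilot_pos`).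
[cite: LANA2026Report, Def. 4.1.3 p. 24] -/
theorem ofInitialThetaDataK_pilot_pos :
    0 < ∑ v ∈ (ofInitialThetaDataK D S).badIn, (ofInitialThetaDataK D S).d v :=
  (ofInitialThetaDataK D S).pilot_pos

/-- **LANA §10.5's hexagon does not commute for the curve `E_K` of the initial Θ-data** (skeleton XIV
`hexagon_not_commute` at the `K`-level input, via gen 0 `hexagon_not_commute_printed`; `l ≥ 5`, `V̲^bad ≠ ∅`).
[cite: LANA2026Report, §10.5 p. 49] -/
theorem hexagon_not_commute_thetaDataK :
    let Q := ofInitialThetaDataK D S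
    Q.toLocalDegrees.thetaDeg Q.toLocalDegrees.s_pos (Q.toLocalDegrees.thetaBPS Q.toLocalDegrees.s_pos).pilot ≠
      Q.toLocalDegrees.qDeg ((Q.toLocalDegrees.thetaLink Q.toLocalDegrees.s_pos).toEquiv
        (Q.toLocalDegrees.thetaBPS Q.toLocalDegrees.s_pos).pilot) :=
  (ofInitialThetaDataK D S).hexagon_not_commute_printed

end QPilotInput

end IUTFork

end Summit.ABC

end
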